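import Summits.QuantumFields.YangMills.Theorems.UnitScaleTiltProp7V0CurrentCentralDerivT3
import Summits.QuantumFields.YangMills.Theorems.UnitScaleTiltProp7V0CurrentHermitianRealityT3
import Summits.QuantumFields.YangMills.Theorems.UnitScaleTiltProp7HWROfRowsFamily
import HarnessLib

/-!
# (R-V₀) brick V3 — THE V₀-GROUP CURRENT (90)–(96) IS HERMITIAN-TRACELESS-VALUED: the row `hV0` of the EX display, DISCHARGED

Route `UnitScaleTilt`, crux EX `MinimiserStabilityRegPr` (stmt-QuantumFields-19200), display of record S13ᴰ ✓p682315.  The display's row `hWR` («`(δ∕δA′)V(U₀)` maps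
Hermitian-traceless (115)-fields of its ball to Hermitian-traceless (−3)-data») was reduced by ✓`Prop7HWROfRowsFamily.hWR_of_rows_family` to the two family rows `hRC`
(the Sect. C regime of `(H̃ᴾ, C̃)`, N06-class) and `hV0` ((R-V₀): the composed V₀-group current `B11Eq90V0GroupComposed.curV0full (rieszτ frobEquiv) tr (bgOfCfg U₀) H̃ᴾ C̃ εC`
of [Balaban1985Variational, (90)–(96) pp.291–292] is Hermitian-traceless-valued on Hermitian-traceless `A′` of the ball).  THIS FILE PROVES `hV0` from `hRC`, so the
`hWR` residue is `hRC` ALONE (★★★`hWR_of_RC_family`).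

Assembly (evidence `LOCATE-RV0-px3g3.md` §2): `curV0full = (T′(A′))ᵗ curV0(T A′)` (✓`curV0full_apply`), `T = (47) = 1 − HD` (✓`fderiv_T47`); lit's transpose row
✓`B11Eq80CurrentRealSubspace.transCur_apply_mem` needs (i) `T′(A′)` to preserve `S`-valued fields (✓`fderiv_Emap_apply_mem`) and scalar fields (they are KILLED:
✓`Prop7SectET3WCurrentReality.fderiv_Emap_apply_eq_zero_of_translate` + the central invariance ✓`Prop7SymAvgTwSym.Ctilde_add_central_of_regPr`), (ii) `T A′` to be `S`-valued
(✓`Emap_apply_mem`), and (iii) the V₀-current `curV0 = curV0prime + curComm` to be `S`-valued on `S`-valued fields — which is §2 here: each one-bond functional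
`ℓ = (∂/∂A(b))V′₀(A, ∂q)` ∕ `(∂/∂A(b))term39(A, ∂q)` at an `SU(2)` reading and Hermitian-traceless `A` is REAL on `S` (✓`Prop7V0CurrentHermitianReality`, V2c) and ZERO on
the centre (✓`Prop7V0CurrentCentralDeriv`, V2b), hence `ρ(ℓ) ∈ S` by the duality row ✓`Prop7SectET3WCurrentRealityLetters.hρ_rieszτ_frobEquiv`.

§1 lit-generic: ★`curV0full_apply_mem` (hypothesis form, any fibre algebra).  §2 `M₂(ℂ)`, any [B11] lattice, `SU(2)`-valued reading: ★★`curV0_isHermitian_trace_zero`.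
§3 the T³ member at the (W-X′) letters of record: ★★★`curV0full_isHermitian_trace_zero_at_record` = E's ∕ S13ᴰ's `hV0` binder with residue {`RC`}; §4 doors:
★★`W80_isHermitian_trace_zero_at_record_of_RC` (member `hWR`, residue {`RC`}) and ★★★`hWR_of_RC_family` (S12ᴰ `hWR` binder VERBATIM ⟸ family row `hRC`).
HONEST SCOPE: algebra and bookkeeping over landed rows; the Sect. C regime `RC` stays displayed (N06-class); no estimate of [Balaban1985Variational] Props 3–4 is
asserted; the EX stub is not touched; rung R3, not Clay.  Helper toward stmt-QuantumFields-19200 (`--supports`), def-free, sorry-free.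
-/

set_option autoImplicit false

noncomputable section

open scoped InnerProductSpace ComplexConjugate Matrix.Norms.L2Operator BigOperators

namespace Summit.QuantumFields.YangMills.Theorems.Prop7V0CurrentReality

open Literature.MathematicalPhysics.QuantumFieldTheory.Balaban1983to89
open Literature.MathematicalPhysics.QuantumFieldTheory.Balaban1983to89.T3ContinuumYM3Torus
open Literature.MathematicalPhysics.QuantumFieldTheory.Balaban1983to89.T3Thm1Carrier
open T3SectALandauChart (eta eta_pos)
open T3PrintedRegularMinimiser (RegPr)
open B9SectCLatticeCarrier (Bond)
open B11Eq115Space (NegSup NegSize Space115 JetSup levWeight)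
open B11Eq111FrakG (nabla115)
open B11Eq174Chart (Regime solA)
open B11Prop6Scheme (Prop4Hyp)
open B11Eq80Current (Emap W80)
open B11Eq90V0GroupComposed (curV0full curV0full_apply T47 T47_apply fderiv_T47)
open B11Eq63V0GroupCurrent (curV0)
open B11Eq90V0primeCurrent (Tsh Ucur curL curL_apply curV0prime curV0prime_apply)
open B11Eq96CommutatorCurrent (curComm curComm_apply)
open B11Eq98CurrentSlot (Jcur)
open B11Eq98V0primeCurrentSlots (rieszτ)
open B9Eq3119DeltaPiCarrier (currentCLM)
open B11Eq80CurrentRealSubspace (transCur_apply_mem Emap_apply_mem fderiv_Emap_apply_mem)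
open Summit.QuantumFields.YangMills.Theorems.Prop7SectET3Transport (periodsT3 siteEquiv bondEquiv bgOfCfg val_bgOfCfg)
open Summit.QuantumFields.YangMills.Theorems.Prop7SectET3HilbertLetters (W₂ frobEquiv toL2)
open Summit.QuantumFields.YangMills.Theorems.Prop7SectET3CurvedPropagators (H1f)
open Summit.QuantumFields.YangMills.Theorems.Prop7SectET3WilsonHessian (DeltaEtaSlot)
open Summit.QuantumFields.YangMills.Theorems.Prop7SectET3DeltaPiPInv (DeltaPiSlotP DeltaPiP_isSymmetric)
open Summit.QuantumFields.YangMills.Theorems.Prop7SymAvgTwSym (CmapTwS Ctilde_add_central_of_regPr)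
open Summit.QuantumFields.YangMills.Theorems.Prop7SectET3JcurReality (val_inv_eq_star_of_mem_su2)
open Summit.QuantumFields.YangMills.Theorems.Prop7HfRealityTrace (H1f_isHermitian_traceless_at_regPr)
open Summit.QuantumFields.YangMills.Theorems.Prop7SectET3RealityPInv (DeltaPiSlotP_toL2_star_of_regPr trace_DeltaPiSlotP_toL2_eq_zero_of_regPr)
open Summit.QuantumFields.YangMills.Theorems.Prop7SectET3WCurrentProp4Rows (prop4Hyp_CmapTwS_conj_zeroJet)
open Summit.QuantumFields.YangMills.Theorems.Prop7SectET3WCurrentRealityLetters (hτS_trace hτZ_trace hρ_rieszτ_frobEquiv Ctilde_isHermitian_trace_zero_of_ball)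
open Summit.QuantumFields.YangMills.Theorems.Prop7SectET3WCurrentReality (fderiv_Emap_apply_eq_zero_of_translate)
open Summit.QuantumFields.YangMills.Theorems.Prop7SectET3WCurrentRealityClosed (W80_isHermitian_trace_zero_at_record_closed)
open Summit.QuantumFields.YangMills.Theorems.Prop7V0CurrentCentralDeriv (dV0primeBond_apply_smul_one_eq_zero dTerm39Bond_apply_smul_one_eq_zero)
open Summit.QuantumFields.YangMills.Theorems.Prop7V0CurrentHermitianReality (conj_dV0primeBond_apply conj_dTerm39Bond_apply)

/-! ## §1 Lit-generic: the composed V₀-group current is `S`-valued, in hypothesis form -/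

section Generic

variable {𝔸 : Type*} [NormedRing 𝔸] [NormedAlgebra ℂ 𝔸] [FiniteDimensional ℂ 𝔸]
variable {d : ℕ} {Pd : Fin d → ℕ} {L η : ℝ} [Fact (0 < L)] [Fact (0 < η)] {lev₀ : Bond d Pd → ℕ} {κ' : Type*} [Fintype κ']
  {lev₁ : κ' → ℕ} {Dc : (Bond d Pd → 𝔸) →ₗ[ℂ] (κ' → 𝔸)}
variable {𝒳 : Type*} [NormedAddCommGroup 𝒳] [NormedSpace ℂ 𝒳]
variable {H : 𝒳 →L[ℂ] Space115 L η lev₀ lev₁ Dc} {C : Space115 L η lev₀ lev₁ Dc → 𝒳} {bH C₂ c₄ aC εC : ℝ}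

/-- ★ **THE COMPOSED V₀-GROUP CURRENT `(T′(A′))ᵗ curV0(T A′)` IS `S`-VALUED FOR `S`-VALUED `A′`** (`‖A′‖ < a_C`), IN HYPOTHESIS FORM: Sect. C regime and Prop. 4 for `C`, the
sector rows of `C` and `H`, the duality rows of `(ρ, τ)`, the row «`curV0` is `S`-valued on `S`-valued fields» and the scalar-sector row `hDZ` of `(HD)′(A′)`.
[cite: Balaban1985Variational, (90) p.291, (47) p.285, (51) p.286, (85)–(89) p.291] -/
theorem curV0full_apply_mem (RC : Regime H 0 C bH 0 C₂ c₄ 0 aC εC) (hP4 : Prop4Hyp C C₂ c₄) (S Z : Submodule ℝ 𝔸) (S𝒳 : Submodule ℝ 𝒳)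
    (ρ : (𝔸 →L[ℂ] ℂ) →L[ℂ] 𝔸) (τ : 𝔸 →L[ℂ] ℂ)
    (hτS : ∀ X ∈ S, ∀ Y ∈ S, starRingEnd ℂ (τ (X * Y)) = τ (X * Y)) (hτZ : ∀ X ∈ S, ∀ z ∈ Z, τ (X * z) = 0)
    (hρ : ∀ ℓ : 𝔸 →L[ℂ] ℂ, (∀ Y ∈ S, starRingEnd ℂ (ℓ Y) = ℓ Y) → (∀ z ∈ Z, ℓ z = 0) → ρ ℓ ∈ S)
    (hC : ∀ Y : Space115 L η lev₀ lev₁ Dc, ‖Y‖ < c₄ → (∀ b, JetSup.equiv _ _ _ Y b ∈ S) → C Y ∈ S𝒳)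
    (hH : ∀ X ∈ S𝒳, ∀ b, JetSup.equiv _ _ _ (H X) b ∈ S)
    (U₀ : Bond d Pd → 𝔸ˣ)
    (hcur : ∀ Y : Space115 L η lev₀ lev₁ Dc, (∀ b, JetSup.equiv _ _ _ Y b ∈ S) → ∀ b, NegSup.equiv _ _ (curV0 (lev₁ := lev₁) (Dc := Dc) ρ τ U₀ Y) b ∈ S)
    {A' : Space115 L η lev₀ lev₁ Dc} (hA' : ‖A'‖ < aC) (hA'S : ∀ b, JetSup.equiv _ _ _ A' b ∈ S)
    (hDZ : ∀ z : Space115 L η lev₀ lev₁ Dc, (∀ b, JetSup.equiv _ _ _ z b ∈ Z) → ∀ b, JetSup.equiv _ _ _ (fderiv ℂ (Emap H C εC) A' z) b ∈ Z)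
    (b : Bond d Pd) : NegSup.equiv _ _ (curV0full ρ τ U₀ H C εC A') b ∈ S := by
  -- `−HD = −(HD)` as maps, so `(−HD)′(A′) = −(HD)′(A′)`
  have hsol : solA H 0 C 0 εC = -Emap H C εC := funext fun Y => by rw [Pi.neg_apply, Emap, neg_neg]
  have hfd : fderiv ℂ (solA H 0 C 0 εC) A' = -fderiv ℂ (Emap H C εC) A' := by rw [hsol, fderiv_neg]
  rw [curV0full_apply, fderiv_T47 RC hP4 hA', hfd]
  refine transCur_apply_mem S Z ρ τ hτS hτZ hρ _ (fun Y hY b' => ?_) (fun z hz b' => ?_) _ (hcur _ (fun b' => ?_)) b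
  · change JetSup.equiv _ _ _ (Y + -(fderiv ℂ (Emap H C εC) A' Y)) b' ∈ S
    rw [← sub_eq_add_neg, JetSup.equiv_sub, Pi.sub_apply]
    exact S.sub_mem (hY b') (fderiv_Emap_apply_mem RC hP4 S S𝒳 hC hH hA' hA'S hY b')
  · change JetSup.equiv _ _ _ (z + -(fderiv ℂ (Emap H C εC) A' z)) b' ∈ Z
    rw [← sub_eq_add_neg, JetSup.equiv_sub, Pi.sub_apply]
    exact Z.sub_mem (hz b') (hDZ z hz b')
  · rw [T47_apply, hsol, Pi.neg_apply, ← sub_eq_add_neg, JetSup.equiv_sub, Pi.sub_apply]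
    exact S.sub_mem (hA'S b') (Emap_apply_mem RC S S𝒳 hC hH hA' hA'S b')

end Generic

/-! ## §2 `M₂(ℂ)`, any [B11] lattice, an `SU(2)`-valued reading: the V₀-current `curV0 = curV0prime + curComm` is Hermitian-traceless-valued -/

section Lattice

variable {d : ℕ} {Pd : Fin d → ℕ} {L η : ℝ} {lev₀ : Bond d Pd → ℕ} {κ' : Type*}
  {lev₁ : κ' → ℕ} {Dc : (Bond d Pd → Matrix (Fin 2) (Fin 2) ℂ) →ₗ[ℂ] (κ' → Matrix (Fin 2) (Fin 2) ℂ)}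

/-- ★★ **THE V₀-GROUP CURRENT `curV0 (rieszτ frobEquiv) tr U₀` IS HERMITIAN-TRACELESS-VALUED ON HERMITIAN-TRACELESS FIELDS** at an `SU(2)`-valued reading `U₀`
(any lattice, any levels): each one-bond functional of (90)∕(93) is real on Hermitian data (V2c) and kills the centre (V2b), so its `ρ`-representative is Hermitian
traceless (✓`hρ_rieszτ_frobEquiv`), and the current at a bond is a finite sum of these. [cite: Balaban1985Variational, (90)–(93) pp.291–292, (51) p.286] -/
theorem curV0_isHermitian_trace_zero (U₀ : Bond d Pd → (Matrix (Fin 2) (Fin 2) ℂ)ˣ)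
    (hU : ∀ b, ((U₀ b : (Matrix (Fin 2) (Fin 2) ℂ)ˣ) : Matrix (Fin 2) (Fin 2) ℂ) ∈ Matrix.specialUnitaryGroup (Fin 2) ℂ)
    (Y : Space115 L η lev₀ lev₁ Dc) (hY : ∀ b, (JetSup.equiv _ _ _ Y b).IsHermitian ∧ (JetSup.equiv _ _ _ Y b).trace = 0) (b : Bond d Pd) :
    (NegSup.equiv _ _ (curV0 (lev₁ := lev₁) (Dc := Dc) (rieszτ frobEquiv) (LinearMap.toContinuousLinearMap (Matrix.traceLinearMap (Fin 2) ℂ ℂ)) U₀ Y) b).IsHermitian ∧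
    (NegSup.equiv _ _ (curV0 (lev₁ := lev₁) (Dc := Dc) (rieszτ frobEquiv) (LinearMap.toContinuousLinearMap (Matrix.traceLinearMap (Fin 2) ℂ ℂ)) U₀ Y) b).trace = 0 := by
  -- the two real sectors
  let S : Submodule ℝ (Matrix (Fin 2) (Fin 2) ℂ) :=
    { carrier := {X | X.IsHermitian ∧ X.trace = 0}
      add_mem' := fun {X Y} hX hY => ⟨hX.1.add hY.1, by rw [Matrix.trace_add, hX.2, hY.2, add_zero]⟩
      zero_mem' := ⟨Matrix.isHermitian_zero, Matrix.trace_zero _ _⟩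
      smul_mem' := fun r X hX => ⟨by
          rw [Matrix.IsHermitian, Matrix.conjTranspose_smul, star_trivial, hX.1.eq],
        by rw [Matrix.trace_smul, hX.2, smul_zero]⟩ }
  let Z : Submodule ℝ (Matrix (Fin 2) (Fin 2) ℂ) :=
    { carrier := {X | ∃ c : ℂ, X = c • (1 : Matrix (Fin 2) (Fin 2) ℂ)}
      add_mem' := fun {X Y} hX hY => by
        obtain ⟨c, rfl⟩ := hX; obtain ⟨d, rfl⟩ := hY
        exact ⟨c + d, (add_smul c d _).symm⟩
      zero_mem' := ⟨0, (zero_smul ℂ _).symm⟩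
      smul_mem' := fun r X hX => by
        obtain ⟨c, rfl⟩ := hX
        exact ⟨r • c, (smul_assoc r c (1 : Matrix (Fin 2) (Fin 2) ℂ)).symm⟩ }
  have hS : ∀ X : Matrix (Fin 2) (Fin 2) ℂ, X ∈ S ↔ X.IsHermitian ∧ X.trace = 0 := fun X => Iff.rfl
  have hZ : ∀ X : Matrix (Fin 2) (Fin 2) ℂ, X ∈ Z ↔ ∃ c : ℂ, X = c • (1 : Matrix (Fin 2) (Fin 2) ℂ) := fun X => Iff.rfl
  -- the reading: `SU(2)`-valued, so unitary and of determinant one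
  have hUc : ∀ (μ : Fin d) (x : B4Sect5Torus.TSite d Pd), ((Ucur U₀ μ x : (Matrix (Fin 2) (Fin 2) ℂ)ˣ) : Matrix (Fin 2) (Fin 2) ℂ) ∈
      Matrix.specialUnitaryGroup (Fin 2) ℂ := fun μ x => hU (x, μ)
  have hUs : ∀ (μ : Fin d) (x : B4Sect5Torus.TSite d Pd), (((Ucur U₀ μ x)⁻¹ : (Matrix (Fin 2) (Fin 2) ℂ)ˣ) : Matrix (Fin 2) (Fin 2) ℂ) =
      star (Ucur U₀ μ x : Matrix (Fin 2) (Fin 2) ℂ) := fun μ x => val_inv_eq_star_of_mem_su2 (hUc μ x)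
  have hUd : ∀ (μ : Fin d) (x : B4Sect5Torus.TSite d Pd), ((Ucur U₀ μ x : (Matrix (Fin 2) (Fin 2) ℂ)ˣ) : Matrix (Fin 2) (Fin 2) ℂ).det = 1 := fun μ x =>
    (Matrix.mem_specialUnitaryGroup_iff.1 (hUc μ x)).2
  -- the field `A = curL Y`: Hermitian and traceless
  set A := curL (JetSup.equiv (levWeight L η lev₀ 1) (levWeight L η lev₁ 2) Dc Y) with hA_def
  have hAH : ∀ (κ : Fin d) (y : B4Sect5Torus.TSite d Pd), star (A κ y) = A κ y := fun κ y => by rw [hA_def, curL_apply]; exact (hY _).1.eq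
  have hAtr : ∀ (κ : Fin d) (y : B4Sect5Torus.TSite d Pd), (A κ y).trace = 0 := fun κ y => by rw [hA_def, curL_apply]; exact (hY _).2
  -- the trace functional
  set τ : Matrix (Fin 2) (Fin 2) ℂ →L[ℂ] ℂ := LinearMap.toContinuousLinearMap (Matrix.traceLinearMap (Fin 2) ℂ ℂ) with hτ_def
  have hτ' : ∀ X : Matrix (Fin 2) (Fin 2) ℂ, τ X = X.trace := fun X => rfl
  have hτ : ∀ a b : Matrix (Fin 2) (Fin 2) ℂ, τ (a * b) = τ (b * a) := fun a b => by rw [hτ', hτ', Matrix.trace_mul_comm]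
  have hτs : ∀ a : Matrix (Fin 2) (Fin 2) ℂ, τ (star a) = starRingEnd ℂ (τ a) := fun a => by
    rw [hτ', hτ', Matrix.star_eq_conjTranspose, Matrix.trace_conjTranspose, Complex.star_def]
  -- each one-bond functional is represented in `S`
  have hV : ∀ q : B4Sect5Torus.TSite d Pd × Fin d × Fin d,
      rieszτ frobEquiv (B11Eq90V0primeBond.dV0primeBond Tsh (Ucur U₀) η τ A q b.2 b.1) ∈ S := fun q =>
    hρ_rieszτ_frobEquiv S Z hS hZ _ (fun W hW => conj_dV0primeBond_apply Tsh (Ucur U₀) hUs τ hτ hτs η hAH q b.2 b.1 ((hS W).1 hW).1.eq)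
      (fun z hz => by
        obtain ⟨c, rfl⟩ := (hZ z).1 hz
        exact dV0primeBond_apply_smul_one_eq_zero Tsh (Ucur U₀) τ hτ' hUd η A hAtr q b.2 b.1 c)
  have hT : ∀ q : B4Sect5Torus.TSite d Pd × Fin d × Fin d,
      rieszτ frobEquiv (B11Eq92CommutatorFunctional.dTerm39Bond Tsh (Ucur U₀) η τ A q b.2 b.1) ∈ S := fun q =>
    hρ_rieszτ_frobEquiv S Z hS hZ _ (fun W hW => conj_dTerm39Bond_apply Tsh (Ucur U₀) hUs τ hτ hτs η hAH q b.2 b.1 ((hS W).1 hW).1.eq)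
      (fun z hz => by
        obtain ⟨c, rfl⟩ := (hZ z).1 hz
        exact dTerm39Bond_apply_smul_one_eq_zero Tsh (Ucur U₀) τ hτ η A q b.2 b.1 c)
  have hmem : NegSup.equiv _ _ (curV0 (lev₁ := lev₁) (Dc := Dc) (rieszτ frobEquiv) τ U₀ Y) b ∈ S := by
    rw [curV0, NegSup.equiv_add, Pi.add_apply, curV0prime_apply, curComm_apply]
    exact S.add_mem (S.sum_mem fun q _ => hV q) (S.sum_mem fun q _ => hT q)
  exact (hS _).1 hmem

end Lattice

/-! ## §3 The T³ member at the (W-X′) letters of record: the row `hV0`, residue {`RC`} -/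

section Record

variable (F : T3Family) (n K : ℕ) (h : n ≤ K) (c₀ cB a : ℝ) [Fact (0 < c₀)] [Fact (0 < cB)] [Fact (0 < (F.L : ℝ))] [Fact (0 < ((F.L : ℝ)⁻¹) ^ (K - n))]

/-- ★★★ **(R-V₀) DISCHARGED — THE ROW `hV0` OF THE EX DISPLAY (E ✓`…WCurrentRealityClosed`'s ∕ S13ᴰ's binder body), RESIDUE {`RC`}**: at `U₀ ∈ 𝔘_k(ε₀)` in the windows
`10⁹L²e ≤ 1`, `10¹²L³ε₀ ≤ 1`, under the Sect. C regime `RC` of `(H̃ᴾ, C̃)` (radius `e∕2`, ✓p664073's Prop.-4 constant), the composed V₀-group current (90)–(96)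
`curV0full (rieszτ frobEquiv) tr (bgOfCfg U₀) H̃ᴾ C̃ εC A′` is Hermitian-traceless-valued for every Hermitian-traceless-valued `A′` with `‖A′‖ < a_C`.
[cite: Balaban1985Variational, (90)–(96) pp.291–292, (51) p.286, (47) p.285; Balaban1985BackgroundPropagators, (3.7) p.391, p.393] -/
theorem curV0full_isHermitian_trace_zero_at_record (ha : 0 ≤ a)
    {ε₀ e : ℝ} (hε₀ : 0 < ε₀) (he : 0 < e) (hWe : 10 ^ 9 * (F.L : ℝ) ^ 2 * e ≤ 1) (hWε : 10 ^ 12 * (F.L : ℝ) ^ 3 * ε₀ ≤ 1)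
    (U₀ : GaugeField (F.P K) 0 (Matrix.specialUnitaryGroup (Fin 2) ℂ)) (hreg : RegPr F n K ε₀ U₀)
    {bH aC εC : ℝ}
    (RC : Regime (H1f F n K h c₀ cB a (DeltaPiSlotP F n K h c₀ cB a) U₀) 0
      (fun A' : Space115 (F.L : ℝ) (((F.L : ℝ)⁻¹) ^ (K - n)) (fun _ : Bond 3 (periodsT3 F K) => K - n)
        (fun _ : Bond 3 (periodsT3 F K) × Fin 3 => K - n) (nabla115 (((F.L : ℝ)⁻¹) ^ (K - n)) (bgOfCfg F K U₀)) =>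
          (-Complex.I) • CmapTwS F n K h U₀ (((((eta F n K : ℝ) : ℂ)) * Complex.I) • fun b : PBond (F.P K) 0 => JetSup.equiv _ _ _ A' (bondEquiv F K b)))
      bH 0 (40 * (2 * (3 * (2 * e + 2700 * (F.L : ℝ) * ε₀))) / e ^ 2) (e / 2) 0 aC εC)
    (A' : Space115 (F.L : ℝ) (((F.L : ℝ)⁻¹) ^ (K - n)) (fun _ : Bond 3 (periodsT3 F K) => K - n)
      (fun _ : Bond 3 (periodsT3 F K) × Fin 3 => K - n) (nabla115 (((F.L : ℝ)⁻¹) ^ (K - n)) (bgOfCfg F K U₀)))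
    (hA' : ‖A'‖ < aC) (hA'S : ∀ b, (JetSup.equiv _ _ _ A' b).IsHermitian ∧ (JetSup.equiv _ _ _ A' b).trace = 0) (b : Bond 3 (periodsT3 F K)) :
    (NegSup.equiv _ _ (curV0full (rieszτ frobEquiv) (LinearMap.toContinuousLinearMap (Matrix.traceLinearMap (Fin 2) ℂ ℂ)) (bgOfCfg F K U₀)
        (H1f F n K h c₀ cB a (DeltaPiSlotP F n K h c₀ cB a) U₀)
        (fun A' : Space115 (F.L : ℝ) (((F.L : ℝ)⁻¹) ^ (K - n)) (fun _ : Bond 3 (periodsT3 F K) => K - n)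
          (fun _ : Bond 3 (periodsT3 F K) × Fin 3 => K - n) (nabla115 (((F.L : ℝ)⁻¹) ^ (K - n)) (bgOfCfg F K U₀)) =>
            (-Complex.I) • CmapTwS F n K h U₀ (((((eta F n K : ℝ) : ℂ)) * Complex.I) • fun b : PBond (F.P K) 0 => JetSup.equiv _ _ _ A' (bondEquiv F K b)))
        εC A') b).IsHermitian ∧
    (NegSup.equiv _ _ (curV0full (rieszτ frobEquiv) (LinearMap.toContinuousLinearMap (Matrix.traceLinearMap (Fin 2) ℂ ℂ)) (bgOfCfg F K U₀)
        (H1f F n K h c₀ cB a (DeltaPiSlotP F n K h c₀ cB a) U₀)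
        (fun A' : Space115 (F.L : ℝ) (((F.L : ℝ)⁻¹) ^ (K - n)) (fun _ : Bond 3 (periodsT3 F K) => K - n)
          (fun _ : Bond 3 (periodsT3 F K) × Fin 3 => K - n) (nabla115 (((F.L : ℝ)⁻¹) ^ (K - n)) (bgOfCfg F K U₀)) =>
            (-Complex.I) • CmapTwS F n K h U₀ (((((eta F n K : ℝ) : ℂ)) * Complex.I) • fun b : PBond (F.P K) 0 => JetSup.equiv _ _ _ A' (bondEquiv F K b)))
        εC A') b).trace = 0 := by
  -- the three real sectors (as in ✓`Prop7SectET3WCurrentReality.W80_isHermitian_trace_zero_of_rows`)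
  let S : Submodule ℝ (Matrix (Fin 2) (Fin 2) ℂ) :=
    { carrier := {X | X.IsHermitian ∧ X.trace = 0}
      add_mem' := fun {X Y} hX hY => ⟨hX.1.add hY.1, by rw [Matrix.trace_add, hX.2, hY.2, add_zero]⟩
      zero_mem' := ⟨Matrix.isHermitian_zero, Matrix.trace_zero _ _⟩
      smul_mem' := fun r X hX => ⟨by
          rw [Matrix.IsHermitian, Matrix.conjTranspose_smul, star_trivial, hX.1.eq],
        by rw [Matrix.trace_smul, hX.2, smul_zero]⟩ }
  let Z : Submodule ℝ (Matrix (Fin 2) (Fin 2) ℂ) :=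
    { carrier := {X | ∃ c : ℂ, X = c • (1 : Matrix (Fin 2) (Fin 2) ℂ)}
      add_mem' := fun {X Y} hX hY => by
        obtain ⟨c, rfl⟩ := hX; obtain ⟨d, rfl⟩ := hY
        exact ⟨c + d, (add_smul c d _).symm⟩
      zero_mem' := ⟨0, (zero_smul ℂ _).symm⟩
      smul_mem' := fun r X hX => by
        obtain ⟨c, rfl⟩ := hX
        exact ⟨r • c, (smul_assoc r c (1 : Matrix (Fin 2) (Fin 2) ℂ)).symm⟩ }
  let SX : Submodule ℝ (PBond (F.P n) 0 → Matrix (Fin 2) (Fin 2) ℂ) :=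
    { carrier := {B | ∀ c, (B c).IsHermitian ∧ (B c).trace = 0}
      add_mem' := fun {X Y} hX hY c => ⟨(hX c).1.add (hY c).1, by rw [Pi.add_apply, Matrix.trace_add, (hX c).2, (hY c).2, add_zero]⟩
      zero_mem' := fun c => ⟨Matrix.isHermitian_zero, Matrix.trace_zero _ _⟩
      smul_mem' := fun r X hX c => ⟨by
          rw [Pi.smul_apply, Matrix.IsHermitian, Matrix.conjTranspose_smul, star_trivial, (hX c).1.eq],
        by rw [Pi.smul_apply, Matrix.trace_smul, (hX c).2, smul_zero]⟩ }
  have hS : ∀ X : Matrix (Fin 2) (Fin 2) ℂ, X ∈ S ↔ X.IsHermitian ∧ X.trace = 0 := fun X => Iff.rfl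
  have hZ : ∀ X : Matrix (Fin 2) (Fin 2) ℂ, X ∈ Z ↔ ∃ c : ℂ, X = c • (1 : Matrix (Fin 2) (Fin 2) ℂ) := fun X => Iff.rfl
  -- the slot rows of `Δ_π^{P⁻¹}` and Prop. 4 for `C̃` (record, by name)
  have hΔx := DeltaPiSlotP_toL2_star_of_regPr F n K h c₀ cB a U₀ ha hε₀ he hWe hWε hreg
  have hΔtr := trace_DeltaPiSlotP_toL2_eq_zero_of_regPr F n K h c₀ cB a U₀ ha hε₀ he hWe hWε hreg
  have hΔsymm : (DeltaPiSlotP F n K h c₀ cB a U₀).IsSymmetric := DeltaPiP_isSymmetric (F := F) (n := n) (K := K) (h := h) (c₀ := c₀) (cB := cB) (a := a) U₀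
  have hP4 := prop4Hyp_CmapTwS_conj_zeroJet F h hε₀ he hWe hWε U₀ hreg
  -- (Z-C): central directions are KILLED by `(HD)′(A′)` (`δ := (160·L)⁻¹`)
  have hL : (0 : ℝ) < F.L := Fact.out
  have hδ : (0 : ℝ) < (160 * (F.L : ℝ))⁻¹ := inv_pos.2 (by positivity)
  have hZC := Ctilde_add_central_of_regPr F h hε₀ he hWe hWε U₀ hreg
  have hDZ : ∀ z : Space115 (F.L : ℝ) (((F.L : ℝ)⁻¹) ^ (K - n)) (fun _ : Bond 3 (periodsT3 F K) => K - n)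
      (fun _ : Bond 3 (periodsT3 F K) × Fin 3 => K - n) (nabla115 (((F.L : ℝ)⁻¹) ^ (K - n)) (bgOfCfg F K U₀)),
      (∀ b', JetSup.equiv _ _ _ z b' ∈ Z) →
      ∀ b', JetSup.equiv _ _ _ (fderiv ℂ (Emap (H1f F n K h c₀ cB a (DeltaPiSlotP F n K h c₀ cB a) U₀)
        (fun A' : Space115 (F.L : ℝ) (((F.L : ℝ)⁻¹) ^ (K - n)) (fun _ : Bond 3 (periodsT3 F K) => K - n)
          (fun _ : Bond 3 (periodsT3 F K) × Fin 3 => K - n) (nabla115 (((F.L : ℝ)⁻¹) ^ (K - n)) (bgOfCfg F K U₀)) =>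
            (-Complex.I) • CmapTwS F n K h U₀ (((((eta F n K : ℝ) : ℂ)) * Complex.I) • fun b : PBond (F.P K) 0 => JetSup.equiv _ _ _ A' (bondEquiv F K b)))
        εC) A' z) b' ∈ Z := by
    intro z hz b'
    have hz1 : 0 < ‖z‖ + 1 := by positivity
    rw [fderiv_Emap_apply_eq_zero_of_translate RC hP4 (div_pos hδ hz1) (fun Y hY t ht => ?_) hA', JetSup.equiv_zero, Pi.zero_apply]
    · exact ⟨0, (zero_smul ℂ _).symm⟩
    · refine hZC Y hY (t • z) (fun b'' => ?_) ?_
      · obtain ⟨c, hc⟩ := hz b''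
        exact ⟨t * c, by rw [JetSup.equiv_smul, Pi.smul_apply, hc, smul_smul]⟩
      · rw [norm_smul]
        calc ‖t‖ * ‖z‖ ≤ ‖t‖ * (‖z‖ + 1) := mul_le_mul_of_nonneg_left (by linarith) (norm_nonneg t)
          _ < (160 * (F.L : ℝ))⁻¹ / (‖z‖ + 1) * (‖z‖ + 1) := mul_lt_mul_of_pos_right ht hz1
          _ = (160 * (F.L : ℝ))⁻¹ := div_mul_cancel₀ _ hz1.ne'
  -- the background is `SU(2)`-valued
  have hU : ∀ b', ((bgOfCfg F K U₀ b' : (Matrix (Fin 2) (Fin 2) ℂ)ˣ) : Matrix (Fin 2) (Fin 2) ℂ) ∈ Matrix.specialUnitaryGroup (Fin 2) ℂ := fun b' => by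
    rw [val_bgOfCfg]; exact (U₀ _).2
  exact (hS _).1 (curV0full_apply_mem RC hP4 S Z SX (rieszτ frobEquiv) (LinearMap.toContinuousLinearMap (Matrix.traceLinearMap (Fin 2) ℂ ℂ)) (hτS_trace S hS)
    (hτZ_trace S Z hS hZ) (hρ_rieszτ_frobEquiv S Z hS hZ) (fun Y hY hYS c => Ctilde_isHermitian_trace_zero_of_ball F h hε₀ he hWe hWε (by linarith) U₀ hreg Y hY hYS c)
    (fun X hX b' => H1f_isHermitian_traceless_at_regPr F n K h c₀ cB a (DeltaPiSlotP F n K h c₀ cB a) hε₀ he hWe hWε U₀ hreg hΔx hΔtr hΔsymm X hX b') (bgOfCfg F K U₀)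
    (fun Y hY b' => (hS _).2 (curV0_isHermitian_trace_zero (bgOfCfg F K U₀) hU Y (fun b'' => (hS _).1 (hY b'')) b')) hA' (fun b' => (hS _).2 (hA'S b')) hDZ b)

/-- ★★ **THE MEMBER `hWR` ROW WITH RESIDUE {`RC`}**: E ✓`W80_isHermitian_trace_zero_at_record_closed` with its `hV0` row supplied by ★★★`curV0full_isHermitian_trace_zero_at_record`.
[cite: Balaban1985Variational, (51) p.286, (84)–(90) pp.290–291] -/
theorem W80_isHermitian_trace_zero_at_record_of_RC (ha : 0 ≤ a)
    {ε₀ e : ℝ} (hε₀ : 0 < ε₀) (he : 0 < e) (hWe : 10 ^ 9 * (F.L : ℝ) ^ 2 * e ≤ 1) (hWε : 10 ^ 12 * (F.L : ℝ) ^ 3 * ε₀ ≤ 1)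
    (U₀ : GaugeField (F.P K) 0 (Matrix.specialUnitaryGroup (Fin 2) ℂ)) (hreg : RegPr F n K ε₀ U₀)
    {bH aC εC : ℝ}
    (RC : Regime (H1f F n K h c₀ cB a (DeltaPiSlotP F n K h c₀ cB a) U₀) 0
      (fun A' : Space115 (F.L : ℝ) (((F.L : ℝ)⁻¹) ^ (K - n)) (fun _ : Bond 3 (periodsT3 F K) => K - n)
        (fun _ : Bond 3 (periodsT3 F K) × Fin 3 => K - n) (nabla115 (((F.L : ℝ)⁻¹) ^ (K - n)) (bgOfCfg F K U₀)) =>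
          (-Complex.I) • CmapTwS F n K h U₀ (((((eta F n K : ℝ) : ℂ)) * Complex.I) • fun b : PBond (F.P K) 0 => JetSup.equiv _ _ _ A' (bondEquiv F K b)))
      bH 0 (40 * (2 * (3 * (2 * e + 2700 * (F.L : ℝ) * ε₀))) / e ^ 2) (e / 2) 0 aC εC)
    (A' : Space115 (F.L : ℝ) (((F.L : ℝ)⁻¹) ^ (K - n)) (fun _ : Bond 3 (periodsT3 F K) => K - n)
      (fun _ : Bond 3 (periodsT3 F K) × Fin 3 => K - n) (nabla115 (((F.L : ℝ)⁻¹) ^ (K - n)) (bgOfCfg F K U₀)))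
    (hA' : ‖A'‖ < aC) (hA'S : ∀ b, (JetSup.equiv _ _ _ A' b).IsHermitian ∧ (JetSup.equiv _ _ _ A' b).trace = 0) (b : Bond 3 (periodsT3 F K)) :
    (NegSup.equiv _ _ (W80 (rieszτ frobEquiv) (LinearMap.toContinuousLinearMap (Matrix.traceLinearMap (Fin 2) ℂ ℂ)) (bgOfCfg F K U₀)
        (H1f F n K h c₀ cB a (DeltaPiSlotP F n K h c₀ cB a) U₀)
        (fun A' : Space115 (F.L : ℝ) (((F.L : ℝ)⁻¹) ^ (K - n)) (fun _ : Bond 3 (periodsT3 F K) => K - n)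
          (fun _ : Bond 3 (periodsT3 F K) × Fin 3 => K - n) (nabla115 (((F.L : ℝ)⁻¹) ^ (K - n)) (bgOfCfg F K U₀)) =>
            (-Complex.I) • CmapTwS F n K h U₀ (((((eta F n K : ℝ) : ℂ)) * Complex.I) • fun b : PBond (F.P K) 0 => JetSup.equiv _ _ _ A' (bondEquiv F K b)))
        εC (Jcur (bgOfCfg F K U₀))
        (currentCLM frobEquiv (fun _ : Bond 3 (periodsT3 F K) × Fin 3 => K - n) (nabla115 (((F.L : ℝ)⁻¹) ^ (K - n)) (bgOfCfg F K U₀)) (DeltaEtaSlot F n K c₀ U₀))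
        A') b).IsHermitian ∧
    (NegSup.equiv _ _ (W80 (rieszτ frobEquiv) (LinearMap.toContinuousLinearMap (Matrix.traceLinearMap (Fin 2) ℂ ℂ)) (bgOfCfg F K U₀)
        (H1f F n K h c₀ cB a (DeltaPiSlotP F n K h c₀ cB a) U₀)
        (fun A' : Space115 (F.L : ℝ) (((F.L : ℝ)⁻¹) ^ (K - n)) (fun _ : Bond 3 (periodsT3 F K) => K - n)
          (fun _ : Bond 3 (periodsT3 F K) × Fin 3 => K - n) (nabla115 (((F.L : ℝ)⁻¹) ^ (K - n)) (bgOfCfg F K U₀)) =>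
            (-Complex.I) • CmapTwS F n K h U₀ (((((eta F n K : ℝ) : ℂ)) * Complex.I) • fun b : PBond (F.P K) 0 => JetSup.equiv _ _ _ A' (bondEquiv F K b)))
        εC (Jcur (bgOfCfg F K U₀))
        (currentCLM frobEquiv (fun _ : Bond 3 (periodsT3 F K) × Fin 3 => K - n) (nabla115 (((F.L : ℝ)⁻¹) ^ (K - n)) (bgOfCfg F K U₀)) (DeltaEtaSlot F n K c₀ U₀))
        A') b).trace = 0 :=
  W80_isHermitian_trace_zero_at_record_closed F n K h c₀ cB a ha hε₀ he hWe hWε U₀ hreg RC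
    (fun A'' hA'' hA''S b' => curV0full_isHermitian_trace_zero_at_record F n K h c₀ cB a ha hε₀ he hWe hWε U₀ hreg RC A'' hA'' hA''S b') A' hA' hA'S b

end Record

/-! ## §4 The family door: S12ᴰ's `hWR` binder VERBATIM from the family row `hRC` alone -/

/-- ★★★ **S13's «HWR FAMILY DOOR», RESIDUE {`hRC`}**: the EX display's row `hWR` (S12ᴰ :176–183) VERBATIM from the family row `hRC` (Sect. C regime of `(H̃ᴾ, C̃)`, N06-class) —
✓`Prop7HWROfRowsFamily.hWR_of_rows_family` with its `hV0` row DISCHARGED by ★★★`curV0full_isHermitian_trace_zero_at_record`.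
[cite: Balaban1985Variational, (51) p.286, (80) p.290, (84)–(96) pp.290–292; Balaban1985BackgroundPropagators, p.393] -/
theorem hWR_of_RC_family
    [hFL : ∀ F : T3Family, Fact (0 < (F.L : ℝ))] [hFη : ∀ (F : T3Family) (k : ℕ), Fact (0 < ((F.L : ℝ)⁻¹) ^ k)]
    (α a₃ ef εC bH : ℕ → ℝ) (hα : ∀ L, 1 < L → 0 < α L) (hef : ∀ L, 1 < L → 0 < ef L)
    (hWe : ∀ L : ℕ, 1 < L → 10 ^ 9 * (L : ℝ) ^ 2 * ef L ≤ 1) (hWε : ∀ L : ℕ, 1 < L → 10 ^ 12 * (L : ℝ) ^ 3 * α L ≤ 1)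
    (c₀ cB : ℕ → ℝ) [hc₀ : ∀ L : ℕ, Fact (0 < c₀ L)] [hcB : ∀ L : ℕ, Fact (0 < cB L)]
    (a : ∀ L : ℕ, Idx L → ℝ) (ha : ∀ (L : ℕ) (i : Idx L), 0 < a L i)
    (hRC : ∀ (L : ℕ), 1 < L → ∀ (i : Idx L) (U₀ : GaugeField (i.1.1.P i.1.2.2) 0 (Matrix.specialUnitaryGroup (Fin 2) ℂ)), RegPr i.1.1 i.1.2.1 i.1.2.2 (α L) U₀ →
      Regime (H1f i.1.1 i.1.2.1 i.1.2.2 i.2.2.le (c₀ L) (cB L) (a L i) (DeltaPiSlotP i.1.1 i.1.2.1 i.1.2.2 i.2.2.le (c₀ L) (cB L) (a L i)) U₀) 0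
        (fun A' : Space115 (i.1.1.L : ℝ) (((i.1.1.L : ℝ)⁻¹) ^ (i.1.2.2 - i.1.2.1)) (fun _ : Bond 3 (periodsT3 i.1.1 i.1.2.2) => i.1.2.2 - i.1.2.1)
            (fun _ : Bond 3 (periodsT3 i.1.1 i.1.2.2) × Fin 3 => i.1.2.2 - i.1.2.1) (nabla115 (((i.1.1.L : ℝ)⁻¹) ^ (i.1.2.2 - i.1.2.1)) (bgOfCfg i.1.1 i.1.2.2 U₀)) =>
          (-Complex.I) • CmapTwS i.1.1 i.1.2.1 i.1.2.2 i.2.2.le U₀ (((((eta i.1.1 i.1.2.1 i.1.2.2 : ℝ) : ℂ)) * Complex.I) • (fun b : PBond (i.1.1.P i.1.2.2) 0 => JetSup.equiv _ _ _ A' (bondEquiv i.1.1 i.1.2.2 b))))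
        (bH L) 0 (40 * (2 * (3 * (2 * ef L + 2700 * (L : ℝ) * α L))) / ef L ^ 2) (ef L / 2) 0 (a₃ L) (εC L)) :
    ∀ (L : ℕ), 1 < L → ∀ (i : Idx L) (U₀ : GaugeField (i.1.1.P i.1.2.2) 0 (Matrix.specialUnitaryGroup (Fin 2) ℂ)), RegPr i.1.1 i.1.2.1 i.1.2.2 (α L) U₀ →
      ∀ A : Space115 (i.1.1.L : ℝ) (((i.1.1.L : ℝ)⁻¹) ^ (i.1.2.2 - i.1.2.1)) (fun _ : Bond 3 (periodsT3 i.1.1 i.1.2.2) => i.1.2.2 - i.1.2.1)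
          (fun _ : Bond 3 (periodsT3 i.1.1 i.1.2.2) × Fin 3 => i.1.2.2 - i.1.2.1) (nabla115 (((i.1.1.L : ℝ)⁻¹) ^ (i.1.2.2 - i.1.2.1)) (bgOfCfg i.1.1 i.1.2.2 U₀)),
        ‖A‖ < a₃ L → (∀ b, (JetSup.equiv _ _ _ A b).IsHermitian ∧ (JetSup.equiv _ _ _ A b).trace = 0) →
        ∀ b, (NegSup.equiv _ _ (W80 (rieszτ frobEquiv) (LinearMap.toContinuousLinearMap (Matrix.traceLinearMap (Fin 2) ℂ ℂ)) (bgOfCfg i.1.1 i.1.2.2 U₀) (H1f i.1.1 i.1.2.1 i.1.2.2 i.2.2.le (c₀ L) (cB L) (a L i) (DeltaPiSlotP i.1.1 i.1.2.1 i.1.2.2 i.2.2.le (c₀ L) (cB L) (a L i)) U₀)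
            (fun A' => (-Complex.I) • CmapTwS i.1.1 i.1.2.1 i.1.2.2 i.2.2.le U₀ (((((eta i.1.1 i.1.2.1 i.1.2.2 : ℝ) : ℂ)) * Complex.I) • (fun b : PBond (i.1.1.P i.1.2.2) 0 => JetSup.equiv _ _ _ A' (bondEquiv i.1.1 i.1.2.2 b)))) (εC L) (Jcur (bgOfCfg i.1.1 i.1.2.2 U₀))
            (currentCLM frobEquiv (fun _ : Bond 3 (periodsT3 i.1.1 i.1.2.2) × Fin 3 => i.1.2.2 - i.1.2.1) (nabla115 (((i.1.1.L : ℝ)⁻¹) ^ (i.1.2.2 - i.1.2.1)) (bgOfCfg i.1.1 i.1.2.2 U₀)) (DeltaEtaSlot i.1.1 i.1.2.1 i.1.2.2 (c₀ L) U₀)) A) b).IsHermitian ∧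
          (NegSup.equiv _ _ (W80 (rieszτ frobEquiv) (LinearMap.toContinuousLinearMap (Matrix.traceLinearMap (Fin 2) ℂ ℂ)) (bgOfCfg i.1.1 i.1.2.2 U₀) (H1f i.1.1 i.1.2.1 i.1.2.2 i.2.2.le (c₀ L) (cB L) (a L i) (DeltaPiSlotP i.1.1 i.1.2.1 i.1.2.2 i.2.2.le (c₀ L) (cB L) (a L i)) U₀)
            (fun A' => (-Complex.I) • CmapTwS i.1.1 i.1.2.1 i.1.2.2 i.2.2.le U₀ (((((eta i.1.1 i.1.2.1 i.1.2.2 : ℝ) : ℂ)) * Complex.I) • (fun b : PBond (i.1.1.P i.1.2.2) 0 => JetSup.equiv _ _ _ A' (bondEquiv i.1.1 i.1.2.2 b)))) (εC L) (Jcur (bgOfCfg i.1.1 i.1.2.2 U₀))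
            (currentCLM frobEquiv (fun _ : Bond 3 (periodsT3 i.1.1 i.1.2.2) × Fin 3 => i.1.2.2 - i.1.2.1) (nabla115 (((i.1.1.L : ℝ)⁻¹) ^ (i.1.2.2 - i.1.2.1)) (bgOfCfg i.1.1 i.1.2.2 U₀)) (DeltaEtaSlot i.1.1 i.1.2.1 i.1.2.2 (c₀ L) U₀)) A) b).trace = 0 := by
  intro L hL i U₀ hreg A hA hAS b
  have hLi : (L : ℝ) = (i.1.1.L : ℝ) := by rw [i.2.1]
  have hWe' : 10 ^ 9 * (i.1.1.L : ℝ) ^ 2 * ef L ≤ 1 := by rw [← hLi]; exact hWe L hL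
  have hWε' : 10 ^ 12 * (i.1.1.L : ℝ) ^ 3 * α L ≤ 1 := by rw [← hLi]; exact hWε L hL
  have hRC' := hRC L hL i U₀ hreg
  rw [hLi] at hRC'
  exact W80_isHermitian_trace_zero_at_record_of_RC i.1.1 i.1.2.1 i.1.2.2 i.2.2.le (c₀ L) (cB L) (a L i) (ha L i).le (hα L hL) (hef L hL) hWe' hWε' U₀ hreg hRC'
    A hA hAS b


/-- ★★★ **THE FAMILY ROW `hV0` OF THE EX DISPLAY (S13ᴰ–S15ᴰ, VERBATIM) FROM THE FAMILY ROW `hRC` ALONE** — ★★★`curV0full_isHermitian_trace_zero_at_record` member by member;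
for the namer: `hV0 := hV0_of_RC_family … hRC` (with `hRC` itself fed by ★px14 ✓`Prop7RCOfRowsFamily.hRC_of_rows_family_B₀`), so `hV0` leaves the display.
[cite: Balaban1985Variational, (90)–(96) pp.291–292, (51) p.286; Balaban1985BackgroundPropagators, (3.7) p.391, p.393] -/
theorem hV0_of_RC_family
    [hFL : ∀ F : T3Family, Fact (0 < (F.L : ℝ))] [hFη : ∀ (F : T3Family) (k : ℕ), Fact (0 < ((F.L : ℝ)⁻¹) ^ k)]
    (α a₃ ef εC bH : ℕ → ℝ) (hα : ∀ L, 1 < L → 0 < α L) (hef : ∀ L, 1 < L → 0 < ef L)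
    (hWe : ∀ L : ℕ, 1 < L → 10 ^ 9 * (L : ℝ) ^ 2 * ef L ≤ 1) (hWε : ∀ L : ℕ, 1 < L → 10 ^ 12 * (L : ℝ) ^ 3 * α L ≤ 1)
    (c₀ cB : ℕ → ℝ) [hc₀ : ∀ L : ℕ, Fact (0 < c₀ L)] [hcB : ∀ L : ℕ, Fact (0 < cB L)]
    (a : ∀ L : ℕ, Idx L → ℝ) (ha : ∀ (L : ℕ) (i : Idx L), 0 < a L i)
    (hRC : ∀ (L : ℕ), 1 < L → ∀ (i : Idx L) (U₀ : GaugeField (i.1.1.P i.1.2.2) 0 (Matrix.specialUnitaryGroup (Fin 2) ℂ)), RegPr i.1.1 i.1.2.1 i.1.2.2 (α L) U₀ →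
      Regime (H1f i.1.1 i.1.2.1 i.1.2.2 i.2.2.le (c₀ L) (cB L) (a L i) (DeltaPiSlotP i.1.1 i.1.2.1 i.1.2.2 i.2.2.le (c₀ L) (cB L) (a L i)) U₀) 0
        (fun A' : Space115 (i.1.1.L : ℝ) (((i.1.1.L : ℝ)⁻¹) ^ (i.1.2.2 - i.1.2.1)) (fun _ : Bond 3 (periodsT3 i.1.1 i.1.2.2) => i.1.2.2 - i.1.2.1)
            (fun _ : Bond 3 (periodsT3 i.1.1 i.1.2.2) × Fin 3 => i.1.2.2 - i.1.2.1) (nabla115 (((i.1.1.L : ℝ)⁻¹) ^ (i.1.2.2 - i.1.2.1)) (bgOfCfg i.1.1 i.1.2.2 U₀)) =>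
          (-Complex.I) • CmapTwS i.1.1 i.1.2.1 i.1.2.2 i.2.2.le U₀ (((((eta i.1.1 i.1.2.1 i.1.2.2 : ℝ) : ℂ)) * Complex.I) • (fun b : PBond (i.1.1.P i.1.2.2) 0 => JetSup.equiv _ _ _ A' (bondEquiv i.1.1 i.1.2.2 b))))
        (bH L) 0 (40 * (2 * (3 * (2 * ef L + 2700 * (L : ℝ) * α L))) / ef L ^ 2) (ef L / 2) 0 (a₃ L) (εC L)) :
    ∀ (L : ℕ), 1 < L → ∀ (i : Idx L) (U₀ : GaugeField (i.1.1.P i.1.2.2) 0 (Matrix.specialUnitaryGroup (Fin 2) ℂ)), RegPr i.1.1 i.1.2.1 i.1.2.2 (α L) U₀ →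
      ∀ A : Space115 (i.1.1.L : ℝ) (((i.1.1.L : ℝ)⁻¹) ^ (i.1.2.2 - i.1.2.1)) (fun _ : Bond 3 (periodsT3 i.1.1 i.1.2.2) => i.1.2.2 - i.1.2.1)
          (fun _ : Bond 3 (periodsT3 i.1.1 i.1.2.2) × Fin 3 => i.1.2.2 - i.1.2.1) (nabla115 (((i.1.1.L : ℝ)⁻¹) ^ (i.1.2.2 - i.1.2.1)) (bgOfCfg i.1.1 i.1.2.2 U₀)),
        ‖A‖ < a₃ L → (∀ b, (JetSup.equiv _ _ _ A b).IsHermitian ∧ (JetSup.equiv _ _ _ A b).trace = 0) →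
        ∀ b, (NegSup.equiv _ _ (curV0full (rieszτ frobEquiv) (LinearMap.toContinuousLinearMap (Matrix.traceLinearMap (Fin 2) ℂ ℂ)) (bgOfCfg i.1.1 i.1.2.2 U₀)
              (H1f i.1.1 i.1.2.1 i.1.2.2 i.2.2.le (c₀ L) (cB L) (a L i) (DeltaPiSlotP i.1.1 i.1.2.1 i.1.2.2 i.2.2.le (c₀ L) (cB L) (a L i)) U₀)
              (fun A' => (-Complex.I) • CmapTwS i.1.1 i.1.2.1 i.1.2.2 i.2.2.le U₀ (((((eta i.1.1 i.1.2.1 i.1.2.2 : ℝ) : ℂ)) * Complex.I) • (fun b : PBond (i.1.1.P i.1.2.2) 0 => JetSup.equiv _ _ _ A' (bondEquiv i.1.1 i.1.2.2 b))))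
              (εC L) A) b).IsHermitian ∧
          (NegSup.equiv _ _ (curV0full (rieszτ frobEquiv) (LinearMap.toContinuousLinearMap (Matrix.traceLinearMap (Fin 2) ℂ ℂ)) (bgOfCfg i.1.1 i.1.2.2 U₀)
              (H1f i.1.1 i.1.2.1 i.1.2.2 i.2.2.le (c₀ L) (cB L) (a L i) (DeltaPiSlotP i.1.1 i.1.2.1 i.1.2.2 i.2.2.le (c₀ L) (cB L) (a L i)) U₀)
              (fun A' => (-Complex.I) • CmapTwS i.1.1 i.1.2.1 i.1.2.2 i.2.2.le U₀ (((((eta i.1.1 i.1.2.1 i.1.2.2 : ℝ) : ℂ)) * Complex.I) • (fun b : PBond (i.1.1.P i.1.2.2) 0 => JetSup.equiv _ _ _ A' (bondEquiv i.1.1 i.1.2.2 b))))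
              (εC L) A) b).trace = 0 := by
  intro L hL i U₀ hreg A hA hAS b
  have hLi : (L : ℝ) = (i.1.1.L : ℝ) := by rw [i.2.1]
  have hWe' : 10 ^ 9 * (i.1.1.L : ℝ) ^ 2 * ef L ≤ 1 := by rw [← hLi]; exact hWe L hL
  have hWε' : 10 ^ 12 * (i.1.1.L : ℝ) ^ 3 * α L ≤ 1 := by rw [← hLi]; exact hWε L hL
  have hRC' := hRC L hL i U₀ hreg
  rw [hLi] at hRC'
  exact curV0full_isHermitian_trace_zero_at_record i.1.1 i.1.2.1 i.1.2.2 i.2.2.le (c₀ L) (cB L) (a L i) (ha L i).le (hα L hL) (hef L hL) hWe' hWε' U₀ hreg hRC'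
    A hA hAS b

end Summit.QuantumFields.YangMills.Theorems.Prop7V0CurrentReality

end
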